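import Mathlib
import Literature.MathematicalPhysics.QuantumFieldTheory.Balaban1983to89.B11Thm1

/-!
# `Balaban1983to89.B11Thm1TwoTier` — the induction on k of [Balaban1985Variational] Theorem 1 RE-ORGANISED around the
repaired background configuration V₀ (cell row G-B11-A1b, repair route R1): a two-tier hypothesis (7″) closed under
V ↦ V₀, approximate boundary averages (14b) instead of the exact (11), Sects. B–F consumed as a black box

T. Bałaban, *The variational problem and background fields in renormalization group method for lattice gauge
theories*, Commun. Math. Phys. **102**, 277–309 (1985), doi:10.1007/bf01229381.  PDF held:
`paper:balaban1985-cmp102-variational-background` (journal page = PDF page + 276).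

CITATION HEADER (lean-in-tree rule 2026-08-18).  SIBLING of `…Balaban1983to89.B11Thm1` (surge node pv12), which it
imports and does not modify.  WHAT IS AT STAKE.  Sect. A p. 279 [3], verbatim: *"We can easily construct a
configuration V₀ on 𝔅′_{k−1} such that it satisfies (7) on 𝔅′_{k−1}, and V₀ = V on ⋃_{j=0}^{k−1} Λ_j, V̄₀ = V on
Λ_k. (11) For example we can take V_{0,b} = V_{b′}, for b ∈ B(b′), b′ ∈ Λ_k and V_{0,b} = 1 for remaining bonds of
B(Λ_k)."* — pv12's leaf `B11Thm1.StepA11` ((7) for V ⇒ (7) for V₀, same ε₁).  The cell's located objection G-B11-A1b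
(gen 3, certified in every gauge in gen 4, `…B11V0Interface` §3, §5): in the multi-domain case Λ_{k−1} ≠ ∅ the printed
V₀ violates (7) on the fine plaquettes joining Λ_{k−1} to B(Λ_k) (their words are bare bond variables V_t⁻¹ of V), for
admissible V and in every gauge.  WHAT IS REPRODUCED HERE (a typed skeleton, statement level + bookkeeping, nothing of
the series asserted): the REPAIRED ARCHITECTURE of the induction (cell record `b2b-balaban-b11-g4/V0-REPAIR.md` §2),
kernel-checked to close with constants uniform in k —
(i) the hypothesis (7) is replaced inside the induction by a two-tier class (7″) = "(7) with ε₁, except that the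
top-level plaquettes lying ≥ 2 units inside Ω_k may have κ₀ε₁", κ₀ = κ₀(d, L) (`TowerT.RegT`; (7) ⊂ (7″) ⊂ (7)[κ₀ε₁],
`TowerT.ClassLaws`); (ii) the leaf (11) ⇒ (7) becomes `StepA11T`: (7″) for V ⇒ (7″) for the GAUGE-COVARIANT V₀ with
the SAME (ε₁, κ₀) (the interface lemma of V0-REPAIR.md §3 + the locality given by (1) p. 277 (= [6] (1.4) p. 77)
*"(L^jη)⁻¹ dist(Ω^c_j, Ω_{j+1}) > RM₁"*); (iii) the exact boundary condition "V̄₀ = V on Λ_k" of (11) is weakened to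
|V̄₀ − V| < C′₁ε₁, which is all that (14) p. 280 consumes (*"|Ū₀^j − V| < C₁ε₁ on Λ_j"*), leaf `StepA13T`;
(iv) Sects. B–F (pv12's `Prop7From14`, b11's `Prop8Printed`, `SectFPrinted`, all level-free) are fed the parameter
κ₀ε₁ and the background constant C₁ ≥ max(L³, C′₁) — p. 302 [26], verbatim: *"for the purpose of the proof of the
regularity properties we can take C₁ = L³"*, so (d, L)-dependent C₁ is the paper's own standard — and return Theorem 1's
clauses with B₃ ↦ B₃κ₀, B₄ ↦ B₄κ₀, a₁ ↦ a₁/κ₀: still "depend on d and L only".  Census: with the repaired leaf the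
printed Theorem 1 (`B11Thm1.Thm1At` at every level, `B11.Thm1Printed` over all levels) follows exactly as in pv12's
`thm1At_allLevels`; the leaves `StepA11T`, `StepA13T`, `BaseK1T` are hypotheses whose mathematical content is the
cell record (G-B11-A1d: proved on paper with κ₀ = 1 + 6(d−1)L(L−1), C′₁ = 2(d−1)L²; G-B11-A2 for k = 1).
Value = repair census of a published step, NOT summit progress.  Unit `b2b-balaban-b11-g4`; staged byte-identically in
`run/shared/lean/pub/pub-balaban/lean/BalabanYm4/Literature/…/B11Thm1TwoTier.lean`.

v2.1 (b2b-balaban-b11-g6, DOCFIX, docstring-only, decls byte-identical): locator correction answering the XREAD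
objection O1 of b2b-balaban-pv26-g3 (GAPS C-pv26g3-11) — the separation inequality *"(L^jη)⁻¹ dist(Ω^c_j, Ω_{j+1}) >
RM₁"* is printed in THIS paper as (1), p. 277 [PDF 1] (*"where R ≧ R₁, the numbers R₁, M₁ are fixed in such a way
that all the results of [3, 5, 6] hold for these numbers"*), and in [6] = CMP 99, 75–102 as part of (1.4), p. 77
(*"Ω_j = B^j(Ω_j^{(j)}), Ω_j is a sum of cubes of a size M₁L^jη, (L^jη)⁻¹ dist(Ω^c_j, Ω_{j+1}) > RM₁ ."*); the
former wording "[6] (1)" conflated the two numberings. Both renders (B11 p001, [6] p003) read as images.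
-/

namespace Literature.MathematicalPhysics.QuantumFieldTheory.Balaban1983to89.B11Thm1TwoTier

open Literature.MathematicalPhysics.QuantumFieldTheory.Balaban1983to89.B11
open Literature.MathematicalPhysics.QuantumFieldTheory.Balaban1983to89.B11Thm1

/-! ## §1. Reparametrisation of Theorem 1's clauses (B₃, κ₀ε₁) ↔ (B₃κ₀, ε₁) -/

/-- (8) at (B₃, κε) is (8) at (B₃κ, ε). [folklore] -/
theorem exists8_reparam (P : VarProblem) (B₃ κ ε : ℝ) (V : P.Bdry) :
    Exists8 P B₃ (κ * ε) V ↔ Exists8 P (B₃ * κ) ε V := by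
  simp only [Exists8, mul_assoc]

/-- The uniqueness clause at (B₃, κε) is the one at (B₃κ, ε). [folklore] -/
theorem unique6_reparam (P : VarProblem) (a₀ B₃ κ ε : ℝ) (V : P.Bdry) :
    Unique6 P a₀ B₃ (κ * ε) V ↔ Unique6 P a₀ (B₃ * κ) ε V := by
  simp only [Unique6, mul_assoc]

/-- (9), (10) at (B₃, B₄, κε) are (9), (10) at (B₃κ, B₄κ, ε). [folklore] -/
theorem regularity_reparam (P : VarProblem) (B₃ B₄ κ ε : ℝ) (U : P.Cfg) (c : P.Cube) :
    Regularity P B₃ B₄ (κ * ε) U c ↔ Regularity P (B₃ * κ) (B₄ * κ) ε U c := by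
  have k3 : ∀ X : ℝ, B₃ * P.sizeM c * (κ * ε) * X = B₃ * κ * P.sizeM c * ε * X := fun X => by ring
  have k4 : ∀ X : ℝ, B₄ * P.sizeM c * (κ * ε) * X = B₄ * κ * P.sizeM c * ε * X := fun X => by ring
  simp only [Regularity, k3, k4]

/-- The regularity clause of Theorem 1 at (B₃, B₄, κε, M) is the one at (B₃κ, B₄κ, ε, M). [folklore] -/
theorem reg910_reparam (P : VarProblem) (B₃ B₄ κ ε M : ℝ) (V : P.Bdry) :
    Reg910 P B₃ B₄ (κ * ε) M V ↔ Reg910 P (B₃ * κ) (B₄ * κ) ε M V := by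
  simp only [Reg910, regularity_reparam, mul_assoc]

/-! ## §2. The repaired tower: two-tier hypothesis (7″), covariant V₀, approximate averages -/

/-- pv12's scale tower extended by the data of the repair (V0-REPAIR.md §2): the constants κ₀, C′₁ (functions of d, L
in the model: κ₀ = 1 + 6(d−1)L(L−1), C′₁ = 2(d−1)L², `…B11V0Interface.kappa0`, `.C1prime`); the two-tier predicate
`RegT n i ε V` = hypothesis (7″): *"|(∂V)(p′) − 1| < ε for p′ ∈ 𝔅_k, except that for the top-level plaquettes all of
whose vertices lie at distance ≥ 2L^kη from Ω_kᶜ the bound is κ₀ε"*; and `V0c` = the gauge-COVARIANT background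
boundary datum (internal bonds of B(y) ↦ 1, crossing bonds ↦ V⟨y,y′⟩ as printed, radial interface bonds
⟨x′,x⟩ ↦ V(Γ_{y′,x′})⁻¹V⟨y′,y⟩) replacing the printed choice `Tower.V0`.  Data only; properties are the leaves below.
[cite: Balaban1985Variational, (7) p.278, (11) p.279] -/
structure TowerT extends Tower where
  κ₀ : ℝ
  C₁' : ℝ
  RegT : (n : ℕ) → (i : I n) → ℝ → (fam n i).Bdry → Prop
  V0c : (n : ℕ) → (i : I (n + 1)) → (fam (n + 1) i).Bdry → (fam n (drop n i)).Bdry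

/-- The dictionary laws of the two-tier class — hypotheses, never asserted: κ₀ ≥ 1, C′₁ ≥ 0; (7) with ε implies (7″)
with ε (the exceptional plaquettes are allowed MORE); (7″) with ε implies (7) with κ₀ε (every plaquette is < κ₀ε);
and the second condition of (14), |Ū^j − V| < b, is monotone in b. [folklore] -/
def TowerT.ClassLaws (T : TowerT) : Prop :=
  1 ≤ T.κ₀ ∧ 0 ≤ T.C₁' ∧
  (∀ (n : ℕ) (i : T.I n) (ε : ℝ) (V : (T.fam n i).Bdry), (T.fam n i).Reg7 ε V → T.RegT n i ε V) ∧
  (∀ (n : ℕ) (i : T.I n) (ε : ℝ) (V : (T.fam n i).Bdry), T.RegT n i ε V → (T.fam n i).Reg7 (T.κ₀ * ε) V) ∧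
  (∀ (n : ℕ) (i : T.I n) (b b' : ℝ) (V : (T.fam n i).Bdry) (U : (T.fam n i).Cfg),
    b ≤ b' → (T.fam n i).Near b V U → (T.fam n i).Near b' V U)

/-- **Repaired leaf (11) ⇒ (7″)** (replaces pv12's `StepA11`; content = V0-REPAIR.md §3, the interface lemma, and §2.3,
locality): if V satisfies (7″) with (ε₁, κ₀) for the level-(k + 1) datum, the covariant V₀ satisfies (7″) with the SAME
(ε₁, κ₀) for the level-k datum — the new interface plaquettes are bounded by (1 + (2 + π)(d−1)L(L−1))ε₁ ≤ κ₀ε₁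
using only NON-exceptional data of V (shell plaquettes, unit and mixed plaquettes within one unit of Ω_kᶜ, block
averages of shell bonds) and NO smallness condition on ε₁ (Jordan's inequality for the logarithm in (15) of [4]), they lie ≥ RM₁ − 2 ≥ 2 units inside Ω_{k−1} by (1) p. 277 (= [6] (1.4) p. 77), interior plaquettes pull back
exactly ({1, V(∂P)}), and V₀ = V on ⋃_{j<k} Λ_j.  A hypothesis here. [cite: Balaban1985Variational, (11) p.279] -/
def StepA11T (T : TowerT) : Prop :=
  ∀ (n : ℕ) (i : T.I (n + 1)) (ε₁ : ℝ) (V : (T.fam (n + 1) i).Bdry),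
    T.RegT (n + 1) i ε₁ V → T.RegT n (T.drop n i) ε₁ (T.V0c n i V)

/-- **Repaired leaf (12) ⇒ (13)/(14)** (replaces pv12's `StepA13`; content = "the form (2)" arithmetic, pv12's
`ineq13_plaquette_factor`/`ineq13_bond_factor`, plus V0-REPAIR.md §3.3): a configuration of the level-k problem in
𝔘_{k−1}(e) ∩ 𝔅_{k−1}(𝔅′_{k−1}, V₀) is, regarded on Ω₀, in 𝔘_k(L³e), and its k-fold averages satisfy
|Ū^k − V| < C′₁ε₁ on Λ_k (EXACT on bonds inside Λ_k, within (π/2)(d−1)(L−1)²ε₁ ≤ C′₁ε₁ on the poking bonds — the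
printed exact "V̄₀ = V on Λ_k" of (11) is not needed by (14)).  A hypothesis here.
[cite: Balaban1985Variational, (12)–(14) p.280] -/
def StepA13T (T : TowerT) : Prop :=
  ∀ (n : ℕ) (i : T.I (n + 1)) (ε₁ e : ℝ) (V : (T.fam (n + 1) i).Bdry) (U : (T.fam n (T.drop n i)).Cfg),
    T.RegT (n + 1) i ε₁ V →
    (T.fam n (T.drop n i)).InU e U → (T.fam n (T.drop n i)).InB (T.V0c n i V) U →
      (T.fam (n + 1) i).InU (T.L ^ 3 * e) (T.lift n i U) ∧ (T.fam (n + 1) i).Near (T.C₁' * ε₁) V (T.lift n i U)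

/-- **Leaf k = 1** (pv12's `BaseK1` at the fed parameter): p. 280 [4], verbatim: *"for k = 1 we do not have any
solutions of the variational problem yet, and then we take simply U₀ = V₀"* — for V with (7″), U₀ = V₀ satisfies (14)
with constant C₁ at the parameter κ₀ε₁.  GAPS G-B11-A2 (only partially verifiable from (7) as printed); a hypothesis.
[cite: Balaban1985Variational, p.280] -/
def BaseK1T (T : TowerT) (B₃ C₁ : ℝ) : Prop :=
  ∀ (i : T.I 0) (ε₁ : ℝ) (V : (T.fam 0 i).Bdry), 0 < ε₁ → T.RegT 0 i ε₁ V →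
    (T.fam 0 i).Sat14 C₁ B₃ (T.κ₀ * ε₁) V (T.base i V)

/-- **Theorem 1″** = Theorem 1 with the hypothesis (7) replaced by the two-tier (7″) at (ε₁, κ₀), at given constants,
for one variational problem. [folklore] -/
def Thm1TAt (T : TowerT) (C : Consts) (n : ℕ) (i : T.I n) : Prop :=
  ∀ ε₁ : ℝ, 0 < ε₁ → ε₁ ≤ C.a₁ → ∀ V : (T.fam n i).Bdry, T.RegT n i ε₁ V →
    Exists8 (T.fam n i).toVarProblem C.B₃ ε₁ V ∧ Unique6 (T.fam n i).toVarProblem C.a₀ C.B₃ ε₁ V ∧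
      Reg910 (T.fam n i).toVarProblem C.B₃ C.B₄ ε₁ (C.Mfun ε₁) V

/-- Theorem 1″ implies Theorem 1 at the same constants ((7) ⊂ (7″)). [folklore] -/
theorem thm1At_of_thm1TAt (T : TowerT) (C : Consts) (cl : T.ClassLaws) (n : ℕ) (i : T.I n)
    (h : Thm1TAt T C n i) : Thm1At C (T.fam n i).toVarProblem :=
  fun ε₁ hε hεa V hV => h ε₁ hε hεa V (cl.2.2.1 n i ε₁ V hV)

/-! ## §3. The re-organised induction closes, uniformly in k -/

/-- **Theorem 1″ at all levels, hence Theorem 1 at all levels, with ONE block of constants** (V0-REPAIR.md §2.4).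
From: the class laws; the dictionary laws of pv12/b11; the repaired leaves `StepA11T` ((7″) ⇒ (7″) for V₀, same ε₁),
`StepA13T` ((12) ⇒ 𝔘_k(L³·) and |Ū₀^k − V| < C′₁ε₁), `BaseK1T`; and Sects. B–F exactly as pv12 consumes them
(`Prop7From14` with background constant C₁ ≥ max(L³, C′₁), b11's `Prop8Printed`, `SectFPrinted` with the Sect.-F
constant B₃) — FED AT THE PARAMETER κ₀ε₁ ((7″) ⊂ (7)[κ₀ε₁]).  Output constants: B₃″ = B₃κ₀, B₄″ = B₄κ₀,
a₁″ = a₁(pv12)/κ₀, M(ε₁) = R₁M₁(a₁″/ε₁), a₀ unchanged — level-free, i.e. "depend on d and L only".  The induction is on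
the STRONGER statement Theorem 1″ (hypothesis (7″)), which is what makes the step close with the same ε₁ at level k − 1:
the inductive hypothesis is applied to V₀ ∈ (7″)(ε₁, κ₀), never to a configuration with a larger ε₁. [folklore] -/
theorem thm1TAt_allLevels (T : TowerT) (B₃ C₁ : ℝ) (hB₃ : 0 < B₃) (hL : 1 ≤ T.L) (hC₁L : T.L ^ 3 ≤ C₁)
    (hC₁' : T.C₁' ≤ C₁) (cl : T.ClassLaws) (laws : ∀ n i, (T.fam n i).LawsA)
    (hA11 : StepA11T T) (hA13 : StepA13T T) (hK1 : BaseK1T T B₃ C₁)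
    (h7 : Prop7From14 T.toTower B₃ C₁) (h8 : Prop8Printed B₃ T.famAllX) (hF : SectFPrinted B₃ T.famAllX) :
    ∃ C : Consts, C.B₃ = B₃ * T.κ₀ ∧ ∀ (n : ℕ) (i : T.I n), Thm1TAt T C n i := by
  obtain ⟨hκ₀, hC₁'0, -, hRegT7, hNear⟩ := cl
  obtain ⟨a₀, a₁', O₁, ha₀, ha₁', hO₁, H7⟩ := h7
  obtain ⟨a₅, ha₅, H8⟩ := h8
  obtain ⟨aF, B₄, RM, haF, hB₄, hRM, HF⟩ := hF
  have hLpos : 0 < T.L := lt_of_lt_of_le one_pos hL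
  have hL3 : 1 ≤ T.L ^ 3 := one_le_pow₀ hL
  have hC₁pos : 0 < C₁ := lt_of_lt_of_le (lt_of_lt_of_le one_pos hL3) hC₁L
  have hκ₀pos : 0 < T.κ₀ := lt_of_lt_of_le one_pos hκ₀
  have hK : 0 < O₁ * C₁ * B₃ := by positivity
  -- pv12's final a₁ (p. 304) at the fed parameter, then divided by κ₀
  set b₁ : ℝ := min (min a₁' aF) (min (a₅ / (O₁ * C₁ * B₃)) (a₀ / B₃)) with hb₁def
  have hb₁pos : 0 < b₁ := by
    simp only [hb₁def, lt_min_iff]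
    exact ⟨⟨ha₁', haF⟩, div_pos ha₅ hK, div_pos ha₀ hB₃⟩
  have h1 : b₁ ≤ a₁' := le_trans (min_le_left _ _) (min_le_left _ _)
  have h2 : b₁ ≤ aF := le_trans (min_le_left _ _) (min_le_right _ _)
  have h3 : b₁ ≤ a₅ / (O₁ * C₁ * B₃) := le_trans (min_le_right _ _) (min_le_left _ _)
  have h4 : b₁ ≤ a₀ / B₃ := le_trans (min_le_right _ _) (min_le_right _ _)
  set a₁ : ℝ := b₁ / T.κ₀ with ha₁def
  have ha₁pos : 0 < a₁ := div_pos hb₁pos hκ₀pos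
  have hB₃a₁ : B₃ * T.κ₀ * a₁ ≤ a₀ := by
    have e1 : B₃ * T.κ₀ * a₁ = B₃ * b₁ := by rw [ha₁def]; field_simp
    have e2 : B₃ * b₁ ≤ a₀ := by
      have := (le_div_iff₀ hB₃).1 h4
      linarith [mul_comm B₃ b₁]
    linarith
  have hMpos : ∀ e : ℝ, 0 < e → 0 < RM * (a₁ / e) := fun e he => by positivity
  -- the level-free step of pv12 (Sects. B–F from a background (14)), to be used at the parameter κ₀ε₁
  have step := thm1_clauses_of_background T.toTower B₃ C₁ a₀ a₁' O₁ a₅ aF B₄ RM b₁ hK hRM h1 h2 h3 laws H7 H8 HF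
  refine ⟨⟨a₀, a₁, B₃ * T.κ₀, B₄ * T.κ₀, fun e => RM * (a₁ / e), ha₀, ha₁pos, by positivity, by positivity,
    hB₃a₁, hMpos⟩, rfl, ?_⟩
  -- conversion of the step's output at (B₃, κ₀ε₁) into Theorem 1″'s clauses at (B₃κ₀, ε₁)
  have conv : ∀ (n : ℕ) (i : T.I n) (ε₁ : ℝ), 0 < ε₁ → ε₁ ≤ a₁ → ∀ (V : (T.fam n i).Bdry)
      (U₀ : (T.fam n i).Cfg), T.RegT n i ε₁ V → (T.fam n i).Sat14 C₁ B₃ (T.κ₀ * ε₁) V U₀ →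
      Exists8 (T.fam n i).toVarProblem (B₃ * T.κ₀) ε₁ V ∧
        Unique6 (T.fam n i).toVarProblem a₀ (B₃ * T.κ₀) ε₁ V ∧
        Reg910 (T.fam n i).toVarProblem (B₃ * T.κ₀) (B₄ * T.κ₀) ε₁ (RM * (a₁ / ε₁)) V := by
    intro n i ε₁ hε hεa V U₀ hV h14
    have hε' : 0 < T.κ₀ * ε₁ := mul_pos hκ₀pos hε
    have hεb : T.κ₀ * ε₁ ≤ b₁ := by
      have := (le_div_iff₀ hκ₀pos).1 hεa
      linarith [mul_comm T.κ₀ ε₁]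
    have hV7 : (T.fam n i).Reg7 (T.κ₀ * ε₁) V := hRegT7 n i ε₁ V hV
    obtain ⟨hE, hU, hR⟩ := step n i (T.κ₀ * ε₁) hε' hεb V hV7 U₀ h14
    have hM : RM * (b₁ / (T.κ₀ * ε₁)) = RM * (a₁ / ε₁) := by
      rw [ha₁def, div_div]
    refine ⟨(exists8_reparam _ _ _ _ _).1 hE, (unique6_reparam _ _ _ _ _ _).1 hU, ?_⟩
    rw [← hM]
    exact (reg910_reparam _ _ _ _ _ _ _).1 hR
  intro n
  induction n with
  | zero =>
      -- k = 1: U₀ = V₀ (leaf `BaseK1T`), then Sects. B–F at κ₀ε₁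
      intro i ε₁ hε hεa V hV
      exact conv 0 i ε₁ hε hεa V (T.base i V) hV (hK1 i ε₁ V hε hV)
  | succ n ih =>
      -- k ↦ k + 1: V₀ ∈ (7″)(ε₁, κ₀) by `StepA11T`, U_k(V₀) by the inductive hypothesis (SAME ε₁), lifted by
      -- `StepA13T`, hence (14) at the parameter κ₀ε₁ by monotonicity; then Sects. B–F at κ₀ε₁
      intro i ε₁ hε hεa V hV
      have hV₀ : T.RegT n (T.drop n i) ε₁ (T.V0c n i V) := hA11 n i ε₁ V hV
      obtain ⟨U', hU'in, hU'B, -⟩ := (ih (T.drop n i) ε₁ hε hεa (T.V0c n i V) hV₀).1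
      obtain ⟨h13U, h13N⟩ := hA13 n i ε₁ (B₃ * T.κ₀ * ε₁) V U' hV hU'in hU'B
      obtain ⟨⟨Lmono, -, -, -⟩, -⟩ := laws (n + 1) i
      have h14 : (T.fam (n + 1) i).Sat14 C₁ B₃ (T.κ₀ * ε₁) V (T.lift n i U') := by
        refine ⟨Lmono _ _ _ ?_ h13U, hNear (n + 1) i _ _ V _ ?_ h13N⟩
        · -- L³·(B₃κ₀ε₁) ≤ C₁·B₃·(κ₀ε₁)
          have : 0 ≤ B₃ * T.κ₀ * ε₁ := by positivity
          nlinarith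
        · -- C′₁ε₁ ≤ C₁(κ₀ε₁)
          have : C₁ * ε₁ ≤ C₁ * (T.κ₀ * ε₁) := by
            apply mul_le_mul_of_nonneg_left _ hC₁pos.le
            nlinarith
          nlinarith
      exact conv (n + 1) i ε₁ hε hεa V (T.lift n i U') hV h14

/-- **Theorem 1 (as printed) at every level of the repaired tower**, constants uniform in k, B₃″ = B₃κ₀.
[folklore] -/
theorem thm1At_allLevels_twoTier (T : TowerT) (B₃ C₁ : ℝ) (hB₃ : 0 < B₃) (hL : 1 ≤ T.L) (hC₁L : T.L ^ 3 ≤ C₁)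
    (hC₁' : T.C₁' ≤ C₁) (cl : T.ClassLaws) (laws : ∀ n i, (T.fam n i).LawsA)
    (hA11 : StepA11T T) (hA13 : StepA13T T) (hK1 : BaseK1T T B₃ C₁)
    (h7 : Prop7From14 T.toTower B₃ C₁) (h8 : Prop8Printed B₃ T.famAllX) (hF : SectFPrinted B₃ T.famAllX) :
    ∃ C : Consts, C.B₃ = B₃ * T.κ₀ ∧ ∀ (n : ℕ) (i : T.I n), Thm1At C (T.fam n i).toVarProblem := by
  obtain ⟨C, hC, H⟩ := thm1TAt_allLevels T B₃ C₁ hB₃ hL hC₁L hC₁' cl laws hA11 hA13 hK1 h7 h8 hF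
  exact ⟨C, hC, fun n i => thm1At_of_thm1TAt T C cl n i (H n i)⟩

/-- … packaged as r2's `B11.Thm1Printed` over the family of ALL levels (one block of constants for every k: "The
constants a₀, a₁, B₃, depend on d and L only"). [folklore] -/
theorem thm1Printed_allLevels_twoTier (T : TowerT) (B₃ C₁ : ℝ) (hB₃ : 0 < B₃) (hL : 1 ≤ T.L)
    (hC₁L : T.L ^ 3 ≤ C₁) (hC₁' : T.C₁' ≤ C₁) (cl : T.ClassLaws) (laws : ∀ n i, (T.fam n i).LawsA)
    (hA11 : StepA11T T) (hA13 : StepA13T T) (hK1 : BaseK1T T B₃ C₁)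
    (h7 : Prop7From14 T.toTower B₃ C₁) (h8 : Prop8Printed B₃ T.famAllX) (hF : SectFPrinted B₃ T.famAllX) :
    Thm1Printed T.famAll := by
  obtain ⟨C, -, H⟩ := thm1At_allLevels_twoTier T B₃ C₁ hB₃ hL hC₁L hC₁' cl laws hA11 hA13 hK1 h7 h8 hF
  exact (thm1Printed_iff T.famAll).2 ⟨C, fun p => H p.1 p.2⟩

/-- The background supply of Sect. A in the repaired form: under Theorem 1″ at all levels and the repaired leaves,
every V with (7″) at (ε₁, κ₀), ε₁ ≤ a₁″, admits a background U₀ with (14) at constant C₁ and parameter κ₀ε₁ — which,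
with pv12's `prop7Printed_of_from14` read at that parameter, is what the (background-free) printed Proposition 7
needs (GAPS G-pv12-1 unchanged in substance). [folklore] -/
theorem background_of_thm1TAt (T : TowerT) (C : Consts) (C₁ : ℝ) (laws : ∀ n i, (T.fam n i).LawsA)
    (cl : T.ClassLaws) (hC₁L : T.L ^ 3 ≤ C₁) (hC₁' : T.C₁' ≤ C₁) (hL : 1 ≤ T.L) (hCB : 0 < C.B₃)
    (hA11 : StepA11T T) (hA13 : StepA13T T) (hK1 : BaseK1T T (C.B₃ / T.κ₀) C₁)
    (H : ∀ (n : ℕ) (i : T.I n), Thm1TAt T C n i)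
    (n : ℕ) (i : T.I n) (ε₁ : ℝ) (hε₁ : 0 < ε₁) (hε₁a : ε₁ ≤ C.a₁) (V : (T.fam n i).Bdry)
    (hV : T.RegT n i ε₁ V) :
    ∃ U₀ : (T.fam n i).Cfg, (T.fam n i).Sat14 C₁ (C.B₃ / T.κ₀) (T.κ₀ * ε₁) V U₀ := by
  obtain ⟨hκ₀, hC₁'0, -, -, hNear⟩ := cl
  have hκ₀pos : 0 < T.κ₀ := lt_of_lt_of_le one_pos hκ₀
  have hL3 : 1 ≤ T.L ^ 3 := one_le_pow₀ hL
  have hC₁pos : 0 < C₁ := lt_of_lt_of_le (lt_of_lt_of_le one_pos hL3) hC₁L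
  cases n with
  | zero => exact ⟨T.base i V, hK1 i ε₁ V hε₁ hV⟩
  | succ n =>
      have hV₀ : T.RegT n (T.drop n i) ε₁ (T.V0c n i V) := hA11 n i ε₁ V hV
      obtain ⟨U', hU'in, hU'B, -⟩ := (H n (T.drop n i) ε₁ hε₁ hε₁a (T.V0c n i V) hV₀).1
      obtain ⟨h13U, h13N⟩ := hA13 n i ε₁ (C.B₃ * ε₁) V U' hV hU'in hU'B
      obtain ⟨⟨Lmono, -, -, -⟩, -⟩ := laws (n + 1) i
      refine ⟨T.lift n i U', Lmono _ _ _ ?_ h13U, hNear (n + 1) i _ _ V _ ?_ h13N⟩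
      · have e : C₁ * (C.B₃ / T.κ₀) * (T.κ₀ * ε₁) = C₁ * (C.B₃ * ε₁) := by field_simp
        rw [e]
        have : 0 ≤ C.B₃ * ε₁ := by positivity
        nlinarith
      · have : C₁ * ε₁ ≤ C₁ * (T.κ₀ * ε₁) := by
          apply mul_le_mul_of_nonneg_left _ hC₁pos.le
          nlinarith
        nlinarith

end Literature.MathematicalPhysics.QuantumFieldTheory.Balaban1983to89.B11Thm1TwoTier
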